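import Literature.NumberTheory.ComplexMultiplication.CMTypeRankCharacters
import Literature.NumberTheory.ComplexMultiplication.CMTypeRankFamiliesPullback
import HarnessLib

/-!
# Kubota's character formula for FAMILIES of CM types over a finite commutative group:
# `rank(Σ) = 1 + #{χ odd : some member Φ_i has Σ_{g : g·x_i ∈ Φ_i} χ(g) ≠ 0}`

Companion of `NumberTheory/ComplexMultiplication/CMTypeRankCharacters` (Kubota 1965 §4 **Lemma 2** = Gordon
**Prop. 9.4.1**, PROVED there for ONE type `Φ ⊆ G` of a finite commutative group `G` acting on itself) and of
`CMTypeRankFamilies` (the family type `Σ = sigmaType Φ ⊆ ⊔_i E_i`; `rank(Σ) = rank Y(MT(∏_i A_{Φ_i}))`, Deligne 1982 I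
Ex. 3.7 (c)).  Here Kubota's Fourier argument is run for a FAMILY: `G` finite commutative acting TRANSITIVELY on each slot
`E_i` (for an abelian field `L ⊇ K_i`: `E_i = Hom(K_i, ℂ) ≅ Gal(L/ℚ)/Gal(L/K_i)`), base points `x_i`, an involution
`ρ ∈ G` (`ρ² = 1`) for which every `Φ_i` is a CM type.

* REDUCTION TO FREE SLOTS (`CMTypeRankFamiliesPullback.typeRank_sigmaType_eq_typeRank_pullback`): the orbit maps
  `g ↦ g·x_i` identify the translates of `Σ` with those of the family `Ψ_i = {g | g·x_i ∈ Φ_i}` of types of `G` acting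
  on ITSELF, `rank(Σ) = rank(⊔_i Ψ_i)`;
* FOURIER ANALYSIS on `⊔_i G` (private): the translate by `h` is `(i, g) ↦ [hg ∈ Ψ_i] = Σ_χ ĉ_i(χ) χ(h) χ(g)`
  with `ĉ_i(χ) = |G|⁻¹ Σ_{s∈Ψ_i} χ(s⁻¹)`; the `ℂ`-span of the translates is the span of the non-zero vectors
  `w_χ = (ĉ_i(χ) χ)_i` (orthogonality `Σ_h χ₀(h⁻¹)·T_h = |G| w_{χ₀}`), linearly independent slot by slot, so
  `rank = #{χ : ∃ i, ĉ_i(χ) ≠ 0}` (`ℚ → ℂ` base change by the companion's `finrank_span_range_ratCast_eq`);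
* **`IsCMTypeWith.typeRank_sigmaType_eq_one_add_ncard_oddCharacters_free`** (free slots) and
  **`IsCMTypeWith.typeRank_sigmaType_eq_one_add_ncard_oddCharacters`** (transitive slots) — **Kubota's Lemma 2 for
  families**: `ĉ_i(1) ≠ 0`, `ĉ_i(χ) = 0` for even `χ ≠ 1`, and for odd `χ`, `ĉ_i(χ) ≠ 0 ⟺ Σ_{s∈Ψ_i} χ̄(s) ≠ 0`; hence
  `rank(Σ) = 1 + #{χ : χ(ρ) = −1 ∧ ∃ i, Σ_{g : g·x_i ∈ Φ_i} χ(g) ≠ 0}` — the rank of `Hg(∏_i A_i)` is the number of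
  odd characters SEEN BY AT LEAST ONE MEMBER; with `S_i` the odd support of `Φ_i`, `rank(Σ) − 1 = |⋃_i S_i| ≤ Σ_i |S_i| =
  Σ_i (rank(Φ_i) − 1)`, equality iff the supports are pairwise disjoint (the quantitative form of
  `CMTypeRankSharedOddCharacter`; number-field dress in `AbelianCMFamilyRankCharacters`).

Everything is PROVED; the only definitions are private Fourier plumbing (as in the companion); no named fact, no `sorry`.

## Sources

* [Kubota1965] T. Kubota, Trans. AMS 118 (1965) 113–122, §4 Lemma 2 (p. 119) (held text
  `paper:doi-10-1090-s0002-9947-1965-0190144-8` p0007); [Deligne1982HodgeCycles] P. Deligne, LNM 900, I Ex. 3.7 (c).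
* [Gordon1999HodgeAVSurvey] B. B. Gordon, *A survey of the Hodge conjecture for abelian varieties*, Prop. 9.4.1; §3
  Theorem (Imai, Murty), 7.5–7.7.
-/

set_option autoImplicit false

noncomputable section

open scoped BigOperators

namespace Literature.NumberTheory.ComplexMultiplication

/-! ### Fourier analysis on `⊔_i G` -/

section Fourier
open AddChar
variable {G : Type*} [CommGroup G] {I : Type*}

/-- A character as a complex function on `G`. [folklore] -/
private def chF (χ : AddChar (Additive G) ℂ) : G → ℂ := fun g => χ (Additive.ofMul g)

/-- `chF χ g = χ(g)`. [folklore] -/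
private theorem chF_apply (χ : AddChar (Additive G) ℂ) (g : G) : chF χ g = χ (Additive.ofMul g) := rfl

/-- `χ(gg') = χ(g)χ(g')`. [folklore] -/
private theorem chF_mul (χ : AddChar (Additive G) ℂ) (g g' : G) : chF χ (g * g') = chF χ g * chF χ g' := by
  simp only [chF_apply, ofMul_mul, map_add_eq_mul]

/-- `χ(g) ≠ 0`. [folklore] -/
private theorem chF_ne_zero (χ : AddChar (Additive G) ℂ) (g : G) : chF χ g ≠ 0 := fun h => by
  have h1 : chF χ g⁻¹ * chF χ g = 1 := by rw [← chF_mul, inv_mul_cancel, chF_apply, ofMul_one, map_zero_eq_one]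
  rw [h, mul_zero] at h1
  exact zero_ne_one h1

/-- `χ(s⁻¹) = (−χ)(s)`. [folklore] -/
private theorem chF_inv (χ : AddChar (Additive G) ℂ) (s : G) : chF χ s⁻¹ = chF (-χ) s := by
  rw [chF_apply, chF_apply, AddChar.neg_apply, ofMul_inv]

variable [Fintype G]

/-- `Σ_g χ(g) = |G| [χ = 1]`. [folklore] -/
private theorem sum_chF_eq_ite (χ : AddChar (Additive G) ℂ) :
    ∑ g : G, chF χ g = if χ = 0 then (Fintype.card G : ℂ) else 0 := by
  have h := AddChar.sum_eq_ite χ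
  rw [show Fintype.card (Additive G) = Fintype.card G from Fintype.card_congr Additive.toMul] at h
  rw [← h]
  exact Fintype.sum_equiv Additive.ofMul _ _ fun x => rfl

/-- `Σ_χ χ(g) = |G| [g = 1]`. [folklore] -/
private theorem sum_chF_apply_eq_ite [DecidableEq G] (g : G) :
    ∑ χ : AddChar (Additive G) ℂ, chF χ g = if g = 1 then (Fintype.card G : ℂ) else 0 := by
  classical
  have h := AddChar.sum_apply_eq_ite (α := Additive G) (Additive.ofMul g)
  simp only [chF_apply]
  rw [h, show Fintype.card (Additive G) = Fintype.card G from Fintype.card_congr Additive.toMul]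
  by_cases hg : g = 1
  · subst hg; simp
  · rw [if_neg hg, if_neg]
    exact fun h' => hg (Additive.ofMul.injective (by rw [h']; rfl))

variable (Ψ : I → Set G)

/-- `[g ∈ Ψ_i]` as a complex number. [folklore] -/
private def wt (i : I) (g : G) : ℂ := (translateInd (Ψ i) (1 : G) g : ℂ)

/-- Kubota's coefficient of the member `i`: `ĉ_i(χ) = |G|⁻¹ Σ_{s∈Ψ_i} χ(s⁻¹)`. [cite: Kubota1965, §4 Lemma 2 (proof)] -/
private def coeff (i : I) (χ : AddChar (Additive G) ℂ) : ℂ :=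
  (Fintype.card G : ℂ)⁻¹ * ∑ s : G, wt Ψ i s * chF χ s⁻¹

/-- The translate of the family type by `h`, complexified: `(i, g) ↦ [hg ∈ Ψ_i]`. [cite: Kubota1965, §4 Lemma 2 (proof)] -/
private def trC (h : G) : (Σ _ : I, G) → ℂ := fun y => (translateInd (sigmaType Ψ) h y : ℂ)

/-- The character vector `w_χ = (ĉ_i(χ) χ)_i` on `⊔_i G`. [cite: Kubota1965, §4 Lemma 2 (proof)] -/
private def wv (χ : AddChar (Additive G) ℂ) : (Σ _ : I, G) → ℂ := fun y => coeff Ψ y.1 χ * chF χ y.2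

omit [Fintype G] in
/-- `T_h(i, g) = [hg ∈ Ψ_i]`. [folklore] -/
private theorem trC_apply (h : G) (i : I) (g : G) : trC Ψ h ⟨i, g⟩ = wt Ψ i (h * g) := by
  simp only [trC, wt, translateInd_sigmaType]
  by_cases hm : h * g ∈ Ψ i
  · rw [translateInd_of_mem (show h • g ∈ Ψ i by rwa [smul_eq_mul]),
      translateInd_of_mem (show (1 : G) • (h * g) ∈ Ψ i by rwa [one_smul])]
  · rw [translateInd_of_not_mem (show ¬h • g ∈ Ψ i by rwa [smul_eq_mul]),
      translateInd_of_not_mem (show ¬(1 : G) • (h * g) ∈ Ψ i by rwa [one_smul])]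

/-- **Fourier expansion of a translate of the family**: `[hg ∈ Ψ_i] = Σ_χ ĉ_i(χ) χ(h) χ(g)`, i.e.
`T_h = Σ_χ χ(h) w_χ`. [cite: Kubota1965, §4 Lemma 2 (proof)] -/
private theorem trC_eq_sum (h : G) : trC Ψ h = ∑ χ : AddChar (Additive G) ℂ, chF χ h • wv Ψ χ := by
  classical
  funext y
  obtain ⟨i, g⟩ := y
  rw [trC_apply]
  simp only [Finset.sum_apply, Pi.smul_apply, smul_eq_mul, wv, coeff]
  have hcard : (Fintype.card G : ℂ) ≠ 0 := Nat.cast_ne_zero.2 Fintype.card_ne_zero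
  have h1 : ∀ χ : AddChar (Additive G) ℂ,
      chF χ h * ((Fintype.card G : ℂ)⁻¹ * (∑ s : G, wt Ψ i s * chF χ s⁻¹) * chF χ g) =
        (Fintype.card G : ℂ)⁻¹ * ∑ s : G, wt Ψ i s * chF χ (h * g * s⁻¹) := by
    intro χ
    rw [Finset.mul_sum, Finset.mul_sum, Finset.sum_mul, Finset.mul_sum]
    refine Finset.sum_congr rfl fun s _ => ?_
    rw [chF_mul, chF_mul]; ring
  simp_rw [h1]
  rw [← Finset.mul_sum, Finset.sum_comm]
  simp_rw [← Finset.mul_sum, sum_chF_apply_eq_ite]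
  have h3 : ∀ s : G, (h * g * s⁻¹ = 1) ↔ s = h * g := fun s => by rw [mul_inv_eq_one]; exact eq_comm
  simp_rw [h3, mul_ite, mul_zero]
  rw [Finset.sum_ite_eq' Finset.univ (h * g), if_pos (Finset.mem_univ _), mul_comm (wt Ψ i (h * g)), ← mul_assoc,
    inv_mul_cancel₀ hcard, one_mul]

/-- **Orthogonality**: `Σ_h χ₀(h⁻¹) T_h = |G| w_{χ₀}`. [cite: Kubota1965, §4 Lemma 2 (proof)] -/
private theorem sum_chF_inv_smul_trC (χ₀ : AddChar (Additive G) ℂ) :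
    ∑ h : G, chF χ₀ h⁻¹ • trC Ψ h = (Fintype.card G : ℂ) • wv Ψ χ₀ := by
  simp_rw [trC_eq_sum, Finset.smul_sum, smul_smul]
  rw [Finset.sum_comm]
  have h1 : ∀ χ : AddChar (Additive G) ℂ, ∑ h : G, (chF χ₀ h⁻¹ * chF χ h) • wv Ψ χ =
      (∑ h : G, chF (χ - χ₀) h) • wv Ψ χ := by
    intro χ
    rw [← Finset.sum_smul]
    congr 1
    refine Finset.sum_congr rfl fun h _ => ?_
    rw [chF_apply, chF_apply, chF_apply, AddChar.sub_apply, ofMul_inv]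
    ring
  simp_rw [h1, sum_chF_eq_ite, sub_eq_zero]
  rw [Finset.sum_eq_single χ₀]
  · rw [if_pos rfl]
  · intro χ _ hne
    rw [if_neg hne, zero_smul]
  · intro h; exact absurd (Finset.mem_univ χ₀) h

/-- `w_χ = 0` iff every coefficient `ĉ_i(χ)` vanishes (`χ(g) ≠ 0`). [folklore] -/
private theorem wv_eq_zero_iff (χ : AddChar (Additive G) ℂ) : wv Ψ χ = 0 ↔ ∀ i, coeff Ψ i χ = 0 := by
  constructor
  · intro h i
    have := congrFun h ⟨i, 1⟩
    simp only [wv, Pi.zero_apply, mul_eq_zero] at this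
    exact this.resolve_right (chF_ne_zero χ 1)
  · intro h
    funext y
    simp only [wv, h y.1, zero_mul, Pi.zero_apply]

/-- **The `ℂ`-span of the translates is the span of the non-zero character vectors `w_χ`.**
[cite: Kubota1965, §4 Lemma 2 (proof)] -/
private theorem span_trC_eq :
    Submodule.span ℂ (Set.range (trC Ψ)) =
      Submodule.span ℂ (wv Ψ '' {χ : AddChar (Additive G) ℂ | wv Ψ χ ≠ 0}) := by
  refine le_antisymm (Submodule.span_le.2 ?_) (Submodule.span_le.2 ?_)
  · rintro _ ⟨h, rfl⟩
    rw [trC_eq_sum]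
    refine Submodule.sum_mem _ fun χ _ => ?_
    by_cases hχ : wv Ψ χ = 0
    · rw [hχ, smul_zero]; exact Submodule.zero_mem _
    · exact Submodule.smul_mem _ _ (Submodule.subset_span ⟨χ, hχ, rfl⟩)
  · rintro _ ⟨χ₀, -, rfl⟩
    have hcard : (Fintype.card G : ℂ) ≠ 0 := Nat.cast_ne_zero.2 Fintype.card_ne_zero
    have hmem : (Fintype.card G : ℂ) • wv Ψ χ₀ ∈ Submodule.span ℂ (Set.range (trC Ψ)) := by
      rw [← sum_chF_inv_smul_trC]
      exact Submodule.sum_mem _ fun h _ => Submodule.smul_mem _ _ (Submodule.subset_span ⟨h, rfl⟩)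
    have := Submodule.smul_mem _ (Fintype.card G : ℂ)⁻¹ hmem
    rwa [smul_smul, inv_mul_cancel₀ hcard, one_smul] at this

/-- **The non-zero `w_χ` are linearly independent** (slot by slot they are multiples of DISTINCT characters).
[cite: Kubota1965, §4 Lemma 2 (proof)] -/
private theorem linearIndependent_wv :
    LinearIndependent ℂ (fun χ : ({χ : AddChar (Additive G) ℂ | wv Ψ χ ≠ 0} : Set (AddChar (Additive G) ℂ)) =>
      wv Ψ χ.1) := by
  classical
  haveI : Fintype ({χ : AddChar (Additive G) ℂ | wv Ψ χ ≠ 0} : Set (AddChar (Additive G) ℂ)) :=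
    Fintype.ofFinite _
  rw [Fintype.linearIndependent_iff]
  intro a ha χ
  -- restrict the relation to the slot `i` witnessing `ĉ_i(χ) ≠ 0`
  have hχ : wv Ψ χ.1 ≠ 0 := χ.2
  have hex : ∃ i, coeff Ψ i χ.1 ≠ 0 := by
    by_contra hne
    push Not at hne
    exact hχ ((wv_eq_zero_iff Ψ χ.1).2 hne)
  obtain ⟨i, hi⟩ := hex
  have hrel : ∑ ψ : ({χ : AddChar (Additive G) ℂ | wv Ψ χ ≠ 0} : Set (AddChar (Additive G) ℂ)),
      (a ψ * coeff Ψ i ψ.1) • chF ψ.1 = 0 := by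
    funext g
    have := congrFun ha ⟨i, g⟩
    simpa only [Finset.sum_apply, Pi.smul_apply, smul_eq_mul, wv, Pi.zero_apply, mul_assoc] using this
  have hli : LinearIndependent ℂ
      (fun ψ : ({χ : AddChar (Additive G) ℂ | wv Ψ χ ≠ 0} : Set (AddChar (Additive G) ℂ)) => chF ψ.1) :=
    (AddChar.linearIndependent (Additive G) ℂ).comp _ Subtype.val_injective
  have := (Fintype.linearIndependent_iff.1 hli) _ hrel χ
  exact (mul_eq_zero.1 this).resolve_right hi

/-- **`rank(⊔_i Ψ_i) = #{χ : w_χ ≠ 0} = #{χ : ∃ i, ĉ_i(χ) ≠ 0}`.** [cite: Kubota1965, §4 Lemma 2 (proof)] -/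
private theorem typeRank_sigmaType_eq_ncard_wv [Fintype I] :
    typeRank G (sigmaType Ψ) = {χ : AddChar (Additive G) ℂ | wv Ψ χ ≠ 0}.ncard := by
  classical
  rw [typeRank_eq_finrank_translateSpan, translateSpan,
    ← finrank_span_range_ratCast_eq (E := Σ _ : I, G) (fun h : G => translateInd (sigmaType Ψ) h)]
  change Module.finrank ℂ (Submodule.span ℂ (Set.range (trC Ψ))) = _
  rw [span_trC_eq]
  haveI : Fintype ({χ : AddChar (Additive G) ℂ | wv Ψ χ ≠ 0} : Set (AddChar (Additive G) ℂ)) :=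
    Fintype.ofFinite _
  have hr : wv Ψ '' {χ : AddChar (Additive G) ℂ | wv Ψ χ ≠ 0} =
      Set.range (fun χ : ({χ : AddChar (Additive G) ℂ | wv Ψ χ ≠ 0} : Set (AddChar (Additive G) ℂ)) =>
        wv Ψ χ.1) := by
    ext f; simp only [Set.mem_image, Set.mem_range, Subtype.exists, exists_prop]
  rw [hr, finrank_span_eq_card (linearIndependent_wv Ψ), Set.ncard_eq_toFinset_card', Set.toFinset_card]

variable {ρ : G} {Ψ}

namespace IsCMTypeWith

variable (h : ∀ i, IsCMTypeWith ρ (Ψ i))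
include h

omit [Fintype G] in
/-- `ρ² = 1`. [folklore] -/
private theorem rho_mul_rho [Nonempty I] : ρ * ρ = 1 := by
  obtain ⟨i⟩ := ‹Nonempty I›
  have := (h i).invol (1 : G)
  simpa [smul_eq_mul] using this

omit [Fintype G] in
/-- `[ρg ∈ Ψ_i] = 1 − [g ∈ Ψ_i]`. [folklore] -/
private theorem wt_rho_mul (i : I) (g : G) : wt Ψ i (ρ * g) = 1 - wt Ψ i g := by
  simp only [wt]
  by_cases hg : g ∈ Ψ i
  · have h1 : (1 : G) • g ∈ Ψ i := by rwa [one_smul]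
    have h2 : ¬(1 : G) • (ρ * g) ∈ Ψ i := by
      rw [one_smul, ← smul_eq_mul]; exact ((h i).mem_iff g).1 hg
    rw [translateInd_of_mem h1, translateInd_of_not_mem h2]; norm_num
  · have h1 : ¬(1 : G) • g ∈ Ψ i := by rwa [one_smul]
    have h2 : (1 : G) • (ρ * g) ∈ Ψ i := by
      rw [one_smul, ← smul_eq_mul]
      by_contra hρg
      exact hg (((h i).mem_iff g).2 hρg)
    rw [translateInd_of_not_mem h1, translateInd_of_mem h2]; norm_num

/-- **`(1 + χ(ρ)) Σ_g [g ∈ Ψ_i] χ(g) = Σ_g χ(g)`** (`G = Ψ_i ⊔ ρΨ_i`). [cite: Kubota1965, §4 Lemma 2 (proof)] -/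
private theorem one_add_mul_sum_wt [Nonempty I] (i : I) (χ : AddChar (Additive G) ℂ) :
    (1 + chF χ ρ) * ∑ g : G, wt Ψ i g * chF χ g = ∑ g : G, chF χ g := by
  have hρ := rho_mul_rho h
  have hχρ : chF χ ρ * chF χ ρ = 1 := by rw [← chF_mul, hρ, chF_apply, ofMul_one, map_zero_eq_one]
  -- `Σ_g [ρg ∈ Ψ] χ(g) = χ(ρ) Σ_g [g ∈ Ψ] χ(g)` (substitute `g ↦ ρg`, `χ(ρ)² = 1`)
  have h1 : ∑ g : G, wt Ψ i (ρ * g) * chF χ g = chF χ ρ * ∑ g : G, wt Ψ i g * chF χ g := by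
    have hre : ∑ g : G, wt Ψ i (ρ * g) * chF χ (ρ * g) = ∑ g : G, wt Ψ i g * chF χ g :=
      Fintype.sum_equiv (Equiv.mulLeft ρ) _ _ (fun g => rfl)
    rw [← hre, Finset.mul_sum]
    refine Finset.sum_congr rfl fun g _ => ?_
    rw [chF_mul]
    linear_combination (-(wt Ψ i (ρ * g) * chF χ g)) * hχρ
  have h2 : ∑ g : G, chF χ g = ∑ g : G, wt Ψ i g * chF χ g + ∑ g : G, wt Ψ i (ρ * g) * chF χ g := by
    rw [← Finset.sum_add_distrib]
    refine Finset.sum_congr rfl fun g _ => ?_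
    rw [wt_rho_mul h]; ring
  rw [h2, h1]; ring

/-- Even non-trivial characters have vanishing sums on every member. [cite: Kubota1965, §4 Lemma 2 (proof)] -/
private theorem sum_wt_eq_zero_of_even [Nonempty I] (i : I) {χ : AddChar (Additive G) ℂ} (hχ : χ ≠ 0)
    (heven : chF χ ρ = 1) : ∑ g : G, wt Ψ i g * chF χ g = 0 := by
  have h1 := one_add_mul_sum_wt h i χ
  rw [heven, sum_chF_eq_ite, if_neg hχ] at h1
  have h2 : (2 : ℂ) * ∑ g : G, wt Ψ i g * chF χ g = 0 := by rw [← h1]; ring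
  exact (mul_eq_zero.1 h2).resolve_left two_ne_zero

/-- `ĉ_i(1) ≠ 0` (`= |Ψ_i|/|G| = ½`). [cite: Kubota1965, §4 Lemma 2 (proof)] -/
private theorem coeff_zero_ne_zero [Nonempty I] (i : I) : coeff Ψ i (0 : AddChar (Additive G) ℂ) ≠ 0 := by
  have hcard : (Fintype.card G : ℂ) ≠ 0 := Nat.cast_ne_zero.2 Fintype.card_ne_zero
  have h1 := one_add_mul_sum_wt h i 0
  simp only [chF_apply, AddChar.zero_apply, mul_one, Finset.sum_const, Finset.card_univ, nsmul_eq_mul] at h1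
  simp only [coeff, chF_apply, AddChar.zero_apply, mul_one, ne_eq, mul_eq_zero, inv_eq_zero, hcard, false_or]
  intro h0
  rw [h0, mul_zero] at h1
  exact hcard h1.symm

omit [Fintype G] in
/-- `χ(ρ) = ±1`. [folklore] -/
private theorem chF_rho [Nonempty I] (χ : AddChar (Additive G) ℂ) : chF χ ρ = 1 ∨ chF χ ρ = -1 := by
  have h1 : chF χ ρ * chF χ ρ = 1 := by
    rw [← chF_mul, rho_mul_rho h, chF_apply, ofMul_one, map_zero_eq_one]
  exact mul_self_eq_one_iff.1 h1

omit [Fintype G] in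
/-- `(−χ)(ρ) = χ(ρ)`. [folklore] -/
private theorem chF_neg_rho [Nonempty I] (χ : AddChar (Additive G) ℂ) : chF (-χ) ρ = chF χ ρ := by
  rw [← chF_inv]; congr 1; rw [inv_eq_iff_mul_eq_one, rho_mul_rho h]

/-- **The characters with some `ĉ_i(χ) ≠ 0` are `1` and the conjugates of the odd characters seen by some member.**
[cite: Kubota1965, §4 Lemma 2 (proof)] -/
private theorem setOf_wv_ne_zero_eq [Nonempty I] :
    {χ : AddChar (Additive G) ℂ | wv Ψ χ ≠ 0} = insert 0 ((fun χ => -χ) ''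
      {χ : AddChar (Additive G) ℂ | chF χ ρ = -1 ∧ ∃ i, ∑ g : G, wt Ψ i g * chF χ g ≠ 0}) := by
  obtain ⟨i₀⟩ := ‹Nonempty I›
  have hcard : (Fintype.card G : ℂ)⁻¹ ≠ 0 := inv_ne_zero (Nat.cast_ne_zero.2 Fintype.card_ne_zero)
  have hcoeff : ∀ (i : I) (χ : AddChar (Additive G) ℂ),
      coeff Ψ i χ = (Fintype.card G : ℂ)⁻¹ * ∑ g : G, wt Ψ i g * chF (-χ) g := fun i χ => by
    simp only [coeff, chF_inv]
  ext χ
  simp only [Set.mem_setOf_eq, Set.mem_insert_iff, Set.mem_image, ne_eq, wv_eq_zero_iff, not_forall]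
  constructor
  · rintro ⟨i, hi⟩
    by_cases h0 : χ = 0
    · exact Or.inl h0
    · refine Or.inr ⟨-χ, ⟨?_, i, ?_⟩, neg_neg χ⟩
      · rw [chF_neg_rho h]
        rcases chF_rho h χ with he | ho
        · exact absurd (by rw [hcoeff, sum_wt_eq_zero_of_even h i (neg_ne_zero.2 h0)
            (by rw [chF_neg_rho h, he]), mul_zero]) hi
        · exact ho
      · intro hs; exact hi (by rw [hcoeff, hs, mul_zero])
  · rintro (rfl | ⟨ψ, ⟨-, i, hψs⟩, rfl⟩)
    · exact ⟨i₀, coeff_zero_ne_zero h i₀⟩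
    · exact ⟨i, by rw [hcoeff, neg_neg]; exact mul_ne_zero hcard hψs⟩

/-- **Kubota's Lemma 2 for a FAMILY of CM types of `G` acting on itself (free slots)**:
`rank(⊔_i Ψ_i) = 1 + #{χ : χ(ρ) = −1 ∧ ∃ i, Σ_{g∈Ψ_i} χ(g) ≠ 0}`. [cite: Kubota1965, §4 Lemma 2]
[cite: Gordon1999HodgeAVSurvey, §9.4.1 (Proposition [B.60])] -/
theorem typeRank_sigmaType_eq_one_add_ncard_oddCharacters_free [Fintype I] [Nonempty I] :
    typeRank G (ComplexMultiplication.sigmaType Ψ) = 1 + {χ : AddChar (Additive G) ℂ | χ (Additive.ofMul ρ) = -1 ∧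
      ∃ i, ∑ g : G, (translateInd (Ψ i) (1 : G) g : ℂ) * χ (Additive.ofMul g) ≠ 0}.ncard := by
  classical
  rw [typeRank_sigmaType_eq_ncard_wv, setOf_wv_ne_zero_eq h]
  set T : Set (AddChar (Additive G) ℂ) :=
    {χ | chF χ ρ = -1 ∧ ∃ i, ∑ g : G, wt Ψ i g * chF χ g ≠ 0} with hT
  have h0 : (0 : AddChar (Additive G) ℂ) ∉ (fun χ => -χ) '' T := by
    rintro ⟨ψ, ⟨hψρ, -⟩, hψ0⟩
    have : ψ = 0 := neg_eq_zero.1 hψ0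
    rw [this, chF_apply, AddChar.zero_apply] at hψρ
    norm_num at hψρ
  rw [Set.ncard_insert_of_notMem h0 (Set.toFinite _), Set.ncard_image_of_injective T neg_injective, add_comm]
  rfl

end IsCMTypeWith

end Fourier

section Transitive
variable {G : Type*} [CommGroup G] [Fintype G] {I : Type*} [Fintype I] [Nonempty I]
  {E : I → Type*} [∀ i, MulAction G (E i)] [∀ i, MulAction.IsPretransitive G (E i)]

/-- **Kubota's Lemma 2 for FAMILIES (Gordon 9.4.1 for products).**  `G` finite commutative acting transitively on
each slot `E_i` (base points `x_i`), `ρ² = 1`, every `Φ_i` a CM type for `ρ`: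
`rank(Σ) = 1 + #{χ : G → ℂˣ | χ(ρ) = −1 and Σ_{g : g·x_i ∈ Φ_i} χ(g) ≠ 0 for some i}` — the rank of the family
(`= rank Hg(∏_i A_{Φ_i})` for abelian CM fields) is one plus the number of ODD characters seen by at least one member.
[cite: Kubota1965, §4 Lemma 2] [cite: Gordon1999HodgeAVSurvey, §9.4.1 (Proposition [B.60]) and §3 Theorem (proof)] -/
theorem IsCMTypeWith.typeRank_sigmaType_eq_one_add_ncard_oddCharacters {ρ : G} (hρ : ρ * ρ = 1)
    {Φ : ∀ i, Set (E i)} (h : ∀ i, IsCMTypeWith ρ (Φ i)) (x : ∀ i, E i) :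
    typeRank G (ComplexMultiplication.sigmaType Φ) = 1 + {χ : AddChar (Additive G) ℂ | χ (Additive.ofMul ρ) = -1 ∧
      ∃ i, ∑ g : G, (translateInd (Φ i) g (x i) : ℂ) * χ (Additive.ofMul g) ≠ 0}.ncard := by
  classical
  have hΨ : ∀ i, IsCMTypeWith ρ ({g : G | g • x i ∈ Φ i} : Set G) := fun i =>
    { mem_iff := fun g => by
        show g • x i ∈ Φ i ↔ ¬(ρ • g) • x i ∈ Φ i
        rw [smul_eq_mul, mul_smul]; exact (h i).mem_iff (g • x i)
      comm := fun g g' => by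
        show g * (ρ * g') = ρ * (g * g')
        rw [← mul_assoc, mul_comm g ρ, mul_assoc]
      invol := fun g => by
        show ρ * (ρ * g) = g
        rw [← mul_assoc, hρ, one_mul] }
  rw [typeRank_sigmaType_eq_typeRank_pullback Φ x,
    IsCMTypeWith.typeRank_sigmaType_eq_one_add_ncard_oddCharacters_free hΨ]
  simp only [translateInd_one_pullback]

end Transitive

end Literature.NumberTheory.ComplexMultiplication
end
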